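import Mathlib.Tactic
import HarnessLib
import HarnessLib.Audit.Tags
import Summits.CriticalPhenomena.PercolationContinuityZ3.Theorems.PercNearOneGluingNoHeavyLowerTailSahiRainbowIsolated

/-!
# Antichains: meets plus joins — the point-split identity and the one-sided step

Support file (seat `prim-masterthm-p1`, gen 35; `--supports stmt-CriticalPhenomena-4575`).  No `sorry`, standard axioms.  Memo
`run/shared/lean/prim/prim-masterthm/FROM-prim-masterthm-p1-g35-AVERAGED-SPLIT.md`.  Companion file `…SahiAntichainSplitAverage`
(effective points, the typed conjectures (Σ) / good point, and the reductions to V5).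

SETTING.  For a finite family `P` of finite sets let `meets P = {a ∩ b : a ≠ b ∈ P}` and `joins P = {a ∪ b : a ≠ b ∈ P}`.  Conjecture **V5**
(gen 34, the hypothesis-free companion of `AntichainMeetsOrJoins` in `…SahiRainbowIsolated`): every ANTICHAIN with `#P ≥ 2` has
`#meets P + #joins P ≥ 2 #P − 2` (tight for `#P = 2`, 3-petal (co)sunflowers and the blow-ups of `C([4],2)`).

NEW HERE ([this work], gen 35).
* **The split identity** (`card_meets_split`, `card_joins_split`, `card_meets_add_card_joins_split`).  At a point `r` write `P = above P r ⊔ below P r`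
  (members containing / avoiding `r`).  Meets of pairs inside `above` contain `r`, all other meets avoid `r`; hence
  `#meets P = #meets (above) + #meets (below) + #newMeets P r`, where `newMeets P r` are the CROSS meets `a ∩ b` (`r ∈ a`, `r ∉ b`) that are
  not meets of two members avoiding `r`; dually for joins.  So `f := #meets + #joins` satisfies `f P = f (above) + f (below) + newLabels P r`
  for EVERY point `r` — the exact bookkeeping behind the induction of the companion file.
* **The one-sided step** (`two_le_newLabels_of_card_above_eq_one`, `…_below_eq_one`): if exactly one member of an antichain contains `r` (or exactly
  one avoids `r`), then `newLabels P r ≥ 2`: either two distinct cross joins (all new), or all cross joins coincide and then every cross meet is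
  new (a coincidence `a ∩ b = d ∩ d'` with `d, d'` avoiding `r` would force `b ⊆ a`).
HONEST FRAMING: V5 itself remains OPEN (see the companion file); everything here is unconditional. [this work]
-/

namespace Summit.CriticalPhenomena.PercolationContinuityZ3.Theorems.SahiColouredDaykin

open Finset

variable {α : Type*} [DecidableEq α]

/-! ### 1. Meets, joins, and the two sides of a point -/

/-- Pairwise meets of DISTINCT members (the set `{a ∩ b : a ≠ b}` of `AntichainMeetsOrJoins`). [this work] -/
def meets (P : Finset (Finset α)) : Finset (Finset α) := P.offDiag.image fun pq => pq.1 ∩ pq.2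

/-- Pairwise joins of DISTINCT members. [this work] -/
def joins (P : Finset (Finset α)) : Finset (Finset α) := P.offDiag.image fun pq => pq.1 ∪ pq.2

/-- The members containing the point `r`. [this work] -/
def above (P : Finset (Finset α)) (r : α) : Finset (Finset α) := P.filter fun a => r ∈ a

/-- The members avoiding the point `r`. [this work] -/
def below (P : Finset (Finset α)) (r : α) : Finset (Finset α) := P.filter fun a => r ∉ a

/-- Cross meets at `r`: `a ∩ b` with `r ∈ a ∈ P`, `r ∉ b ∈ P`. [this work] -/
def crossMeets (P : Finset (Finset α)) (r : α) : Finset (Finset α) := (above P r ×ˢ below P r).image fun pq => pq.1 ∩ pq.2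

/-- Cross joins at `r`: `a ∪ b` with `r ∈ a ∈ P`, `r ∉ b ∈ P`. [this work] -/
def crossJoins (P : Finset (Finset α)) (r : α) : Finset (Finset α) := (above P r ×ˢ below P r).image fun pq => pq.1 ∪ pq.2

/-- NEW meets at `r`: cross meets that are not meets of two members avoiding `r`. [this work] -/
def newMeets (P : Finset (Finset α)) (r : α) : Finset (Finset α) := crossMeets P r \ meets (below P r)

/-- NEW joins at `r`: cross joins that are not joins of two members containing `r`. [this work] -/
def newJoins (P : Finset (Finset α)) (r : α) : Finset (Finset α) := crossJoins P r \ joins (above P r)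

/-- The number of new labels created by the split at `r`. [this work] -/
def newLabels (P : Finset (Finset α)) (r : α) : ℕ := #(newMeets P r) + #(newJoins P r)

/-- Unpacking `meets`. [this work] -/
theorem mem_meets_iff {P : Finset (Finset α)} {Z : Finset α} :
    Z ∈ meets P ↔ ∃ a ∈ P, ∃ b ∈ P, a ≠ b ∧ Z = a ∩ b := by
  unfold meets
  simp only [mem_image, mem_offDiag, Prod.exists]
  constructor
  · rintro ⟨a, b, ⟨ha, hb, hab⟩, rfl⟩; exact ⟨a, ha, b, hb, hab, rfl⟩
  · rintro ⟨a, ha, b, hb, hab, rfl⟩; exact ⟨a, b, ⟨ha, hb, hab⟩, rfl⟩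

/-- Unpacking `joins`. [this work] -/
theorem mem_joins_iff {P : Finset (Finset α)} {W : Finset α} :
    W ∈ joins P ↔ ∃ a ∈ P, ∃ b ∈ P, a ≠ b ∧ W = a ∪ b := by
  unfold joins
  simp only [mem_image, mem_offDiag, Prod.exists]
  constructor
  · rintro ⟨a, b, ⟨ha, hb, hab⟩, rfl⟩; exact ⟨a, ha, b, hb, hab, rfl⟩
  · rintro ⟨a, ha, b, hb, hab, rfl⟩; exact ⟨a, b, ⟨ha, hb, hab⟩, rfl⟩

/-- Unpacking `above`. [this work] -/
theorem mem_above_iff {P : Finset (Finset α)} {r : α} {a : Finset α} : a ∈ above P r ↔ a ∈ P ∧ r ∈ a := by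
  unfold above; rw [mem_filter]

/-- Unpacking `below`. [this work] -/
theorem mem_below_iff {P : Finset (Finset α)} {r : α} {a : Finset α} : a ∈ below P r ↔ a ∈ P ∧ r ∉ a := by
  unfold below; rw [mem_filter]

/-- Unpacking `crossMeets`. [this work] -/
theorem mem_crossMeets_iff {P : Finset (Finset α)} {r : α} {Z : Finset α} :
    Z ∈ crossMeets P r ↔ ∃ a ∈ P, ∃ b ∈ P, r ∈ a ∧ r ∉ b ∧ Z = a ∩ b := by
  unfold crossMeets
  simp only [mem_image, mem_product, mem_above_iff, mem_below_iff, Prod.exists]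
  constructor
  · rintro ⟨a, b, ⟨⟨ha, hra⟩, hb, hrb⟩, rfl⟩; exact ⟨a, ha, b, hb, hra, hrb, rfl⟩
  · rintro ⟨a, ha, b, hb, hra, hrb, rfl⟩; exact ⟨a, b, ⟨⟨ha, hra⟩, hb, hrb⟩, rfl⟩

/-- Unpacking `crossJoins`. [this work] -/
theorem mem_crossJoins_iff {P : Finset (Finset α)} {r : α} {W : Finset α} :
    W ∈ crossJoins P r ↔ ∃ a ∈ P, ∃ b ∈ P, r ∈ a ∧ r ∉ b ∧ W = a ∪ b := by
  unfold crossJoins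
  simp only [mem_image, mem_product, mem_above_iff, mem_below_iff, Prod.exists]
  constructor
  · rintro ⟨a, b, ⟨⟨ha, hra⟩, hb, hrb⟩, rfl⟩; exact ⟨a, ha, b, hb, hra, hrb, rfl⟩
  · rintro ⟨a, ha, b, hb, hra, hrb, rfl⟩; exact ⟨a, b, ⟨⟨ha, hra⟩, hb, hrb⟩, rfl⟩

/-- `above P r ⊆ P`. [this work] -/
theorem above_subset (P : Finset (Finset α)) (r : α) : above P r ⊆ P := filter_subset _ _

/-- `below P r ⊆ P`. [this work] -/
theorem below_subset (P : Finset (Finset α)) (r : α) : below P r ⊆ P := filter_subset _ _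

/-- The two sides partition `P`. [this work] -/
theorem card_above_add_card_below (P : Finset (Finset α)) (r : α) : #(above P r) + #(below P r) = #P := by
  unfold above below
  exact card_filter_add_card_filter_not _

/-- `meets` is monotone. [this work] -/
theorem meets_mono {P Q : Finset (Finset α)} (h : P ⊆ Q) : meets P ⊆ meets Q := by
  intro Z hZ
  obtain ⟨a, ha, b, hb, hab, rfl⟩ := mem_meets_iff.1 hZ
  exact mem_meets_iff.2 ⟨a, h ha, b, h hb, hab, rfl⟩

/-- `joins` is monotone. [this work] -/
theorem joins_mono {P Q : Finset (Finset α)} (h : P ⊆ Q) : joins P ⊆ joins Q := by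
  intro W hW
  obtain ⟨a, ha, b, hb, hab, rfl⟩ := mem_joins_iff.1 hW
  exact mem_joins_iff.2 ⟨a, h ha, b, h hb, hab, rfl⟩

/-! ### 2. The split identity -/

/-- Meets decompose at `r`: inside `above`, or (inside `below` ∪ cross). [this work] -/
theorem meets_eq_union (P : Finset (Finset α)) (r : α) :
    meets P = meets (above P r) ∪ (meets (below P r) ∪ crossMeets P r) := by
  ext Z
  simp only [mem_union]
  constructor
  · intro hZ
    obtain ⟨a, ha, b, hb, hab, rfl⟩ := mem_meets_iff.1 hZ
    by_cases hra : r ∈ a <;> by_cases hrb : r ∈ b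
    · exact Or.inl (mem_meets_iff.2 ⟨a, mem_above_iff.2 ⟨ha, hra⟩, b, mem_above_iff.2 ⟨hb, hrb⟩, hab, rfl⟩)
    · exact Or.inr (Or.inr (mem_crossMeets_iff.2 ⟨a, ha, b, hb, hra, hrb, rfl⟩))
    · exact Or.inr (Or.inr (mem_crossMeets_iff.2 ⟨b, hb, a, ha, hrb, hra, inter_comm a b⟩))
    · exact Or.inr (Or.inl (mem_meets_iff.2 ⟨a, mem_below_iff.2 ⟨ha, hra⟩, b, mem_below_iff.2 ⟨hb, hrb⟩, hab, rfl⟩))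
  · rintro (hZ | hZ | hZ)
    · exact meets_mono (above_subset P r) hZ
    · exact meets_mono (below_subset P r) hZ
    · obtain ⟨a, ha, b, hb, hra, hrb, rfl⟩ := mem_crossMeets_iff.1 hZ
      have hab : a ≠ b := by rintro rfl; exact hrb hra
      exact mem_meets_iff.2 ⟨a, ha, b, hb, hab, rfl⟩

/-- Joins decompose at `r`: inside `below`, or (inside `above` ∪ cross). [this work] -/
theorem joins_eq_union (P : Finset (Finset α)) (r : α) :
    joins P = joins (below P r) ∪ (joins (above P r) ∪ crossJoins P r) := by
  ext W
  simp only [mem_union]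
  constructor
  · intro hW
    obtain ⟨a, ha, b, hb, hab, rfl⟩ := mem_joins_iff.1 hW
    by_cases hra : r ∈ a <;> by_cases hrb : r ∈ b
    · exact Or.inr (Or.inl (mem_joins_iff.2 ⟨a, mem_above_iff.2 ⟨ha, hra⟩, b, mem_above_iff.2 ⟨hb, hrb⟩, hab, rfl⟩))
    · exact Or.inr (Or.inr (mem_crossJoins_iff.2 ⟨a, ha, b, hb, hra, hrb, rfl⟩))
    · exact Or.inr (Or.inr (mem_crossJoins_iff.2 ⟨b, hb, a, ha, hrb, hra, union_comm a b⟩))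
    · exact Or.inl (mem_joins_iff.2 ⟨a, mem_below_iff.2 ⟨ha, hra⟩, b, mem_below_iff.2 ⟨hb, hrb⟩, hab, rfl⟩)
  · rintro (hW | hW | hW)
    · exact joins_mono (below_subset P r) hW
    · exact joins_mono (above_subset P r) hW
    · obtain ⟨a, ha, b, hb, hra, hrb, rfl⟩ := mem_crossJoins_iff.1 hW
      have hab : a ≠ b := by rintro rfl; exact hrb hra
      exact mem_joins_iff.2 ⟨a, ha, b, hb, hab, rfl⟩

/-- Meets of pairs inside `above P r` contain `r`. [this work] -/
theorem mem_of_mem_meets_above {P : Finset (Finset α)} {r : α} {Z : Finset α} (hZ : Z ∈ meets (above P r)) : r ∈ Z := by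
  obtain ⟨a, ha, b, hb, _, rfl⟩ := mem_meets_iff.1 hZ
  exact mem_inter.2 ⟨(mem_above_iff.1 ha).2, (mem_above_iff.1 hb).2⟩

/-- Meets of pairs inside `below P r`, and cross meets, avoid `r`. [this work] -/
theorem not_mem_of_mem_meets_below_union {P : Finset (Finset α)} {r : α} {Z : Finset α}
    (hZ : Z ∈ meets (below P r) ∪ crossMeets P r) : r ∉ Z := by
  rcases mem_union.1 hZ with hZ | hZ
  · obtain ⟨a, ha, b, _, _, rfl⟩ := mem_meets_iff.1 hZ
    exact fun h => (mem_below_iff.1 ha).2 (mem_inter.1 h).1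
  · obtain ⟨a, _, b, _, _, hrb, rfl⟩ := mem_crossMeets_iff.1 hZ
    exact fun h => hrb (mem_inter.1 h).2

/-- Joins of pairs inside `below P r` avoid `r`. [this work] -/
theorem not_mem_of_mem_joins_below {P : Finset (Finset α)} {r : α} {W : Finset α} (hW : W ∈ joins (below P r)) : r ∉ W := by
  obtain ⟨a, ha, b, hb, _, rfl⟩ := mem_joins_iff.1 hW
  intro h
  rcases mem_union.1 h with h | h
  · exact (mem_below_iff.1 ha).2 h
  · exact (mem_below_iff.1 hb).2 h

/-- Joins of pairs inside `above P r`, and cross joins, contain `r`. [this work] -/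
theorem mem_of_mem_joins_above_union {P : Finset (Finset α)} {r : α} {W : Finset α}
    (hW : W ∈ joins (above P r) ∪ crossJoins P r) : r ∈ W := by
  rcases mem_union.1 hW with hW | hW
  · obtain ⟨a, ha, b, _, _, rfl⟩ := mem_joins_iff.1 hW
    exact mem_union_left _ (mem_above_iff.1 ha).2
  · obtain ⟨a, _, b, _, hra, _, rfl⟩ := mem_crossJoins_iff.1 hW
    exact mem_union_left _ hra

/-- **Split identity for meets**: `#meets P = #meets (above) + #meets (below) + #newMeets`. [this work] -/
theorem card_meets_split (P : Finset (Finset α)) (r : α) :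
    #(meets P) = #(meets (above P r)) + #(meets (below P r)) + #(newMeets P r) := by
  have hdisj : Disjoint (meets (above P r)) (meets (below P r) ∪ crossMeets P r) := by
    rw [disjoint_left]
    intro Z h1 h2
    exact not_mem_of_mem_meets_below_union h2 (mem_of_mem_meets_above h1)
  have h2 : #(meets (below P r) ∪ crossMeets P r) = #(meets (below P r)) + #(newMeets P r) := by
    unfold newMeets
    rw [← union_sdiff_self_eq_union, card_union_of_disjoint disjoint_sdiff]
  rw [meets_eq_union P r, card_union_of_disjoint hdisj, h2, Nat.add_assoc]

/-- **Split identity for joins**: `#joins P = #joins (above) + #joins (below) + #newJoins`. [this work] -/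
theorem card_joins_split (P : Finset (Finset α)) (r : α) :
    #(joins P) = #(joins (above P r)) + #(joins (below P r)) + #(newJoins P r) := by
  have hdisj : Disjoint (joins (below P r)) (joins (above P r) ∪ crossJoins P r) := by
    rw [disjoint_left]
    intro W h1 h2
    exact not_mem_of_mem_joins_below h1 (mem_of_mem_joins_above_union h2)
  have h2 : #(joins (above P r) ∪ crossJoins P r) = #(joins (above P r)) + #(newJoins P r) := by
    unfold newJoins
    rw [← union_sdiff_self_eq_union, card_union_of_disjoint disjoint_sdiff]
  rw [joins_eq_union P r, card_union_of_disjoint hdisj, h2]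
  omega

/-- **Split identity** for `f = #meets + #joins`: `f P = f (above P r) + f (below P r) + newLabels P r`, for every point `r`. [this work] -/
theorem card_meets_add_card_joins_split (P : Finset (Finset α)) (r : α) :
    #(meets P) + #(joins P) =
      (#(meets (above P r)) + #(joins (above P r))) + (#(meets (below P r)) + #(joins (below P r))) + newLabels P r := by
  rw [card_meets_split P r, card_joins_split P r]
  unfold newLabels
  omega

/-! ### 3. The one-sided step: a side with a single member creates two new labels -/

/-- Cross joins are new when at most one member contains `r` (then `joins (above P r) = ∅`). [this work] -/
theorem joins_eq_empty_of_card_le_one {Q : Finset (Finset α)} (h : #Q ≤ 1) : joins Q = ∅ := by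
  apply eq_empty_of_forall_notMem
  intro W hW
  obtain ⟨a, ha, b, hb, hab, _⟩ := mem_joins_iff.1 hW
  exact hab (card_le_one.1 h a ha b hb)

/-- Dually `meets Q = ∅` when `#Q ≤ 1`. [this work] -/
theorem meets_eq_empty_of_card_le_one {Q : Finset (Finset α)} (h : #Q ≤ 1) : meets Q = ∅ := by
  apply eq_empty_of_forall_notMem
  intro Z hZ
  obtain ⟨a, ha, b, hb, hab, _⟩ := mem_meets_iff.1 hZ
  exact hab (card_le_one.1 h a ha b hb)

/-- **One-sided step (a single member contains `r`).**  For an antichain with at least two members, if exactly one member contains `r`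
then the split at `r` creates at least two new labels: either two distinct cross joins (all new), or all cross joins coincide and then
every cross meet is new (a cross meet `a ∩ b = d ∩ d'` with `d, d'` avoiding `r` would force `b ⊆ a`). [this work] -/
theorem two_le_newLabels_of_card_above_eq_one {P : Finset (Finset α)} {r : α}
    (hanti : IsAntichain (· ⊆ ·) (P : Set (Finset α))) (h2 : 2 ≤ #P) (h1 : #(above P r) = 1) :
    2 ≤ newLabels P r := by
  obtain ⟨a, haA⟩ := card_eq_one.1 h1
  have ha : a ∈ above P r := by rw [haA]; exact mem_singleton_self a
  obtain ⟨haP, hra⟩ := mem_above_iff.1 ha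
  -- a member avoiding r
  have hB : (below P r).Nonempty := by
    rw [← card_pos]
    have := card_above_add_card_below P r
    omega
  obtain ⟨b, hb⟩ := hB
  obtain ⟨hbP, hrb⟩ := mem_below_iff.1 hb
  -- all cross joins are new
  have hJ : joins (above P r) = ∅ := joins_eq_empty_of_card_le_one (by rw [h1])
  have hnewJ : newJoins P r = crossJoins P r := by unfold newJoins; rw [hJ, sdiff_empty]
  have hWb : a ∪ b ∈ crossJoins P r := mem_crossJoins_iff.2 ⟨a, haP, b, hbP, hra, hrb, rfl⟩
  unfold newLabels
  rw [hnewJ]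
  by_cases htwo : ∃ b' ∈ below P r, a ∪ b' ≠ a ∪ b
  · -- two distinct cross joins
    obtain ⟨b', hb', hne⟩ := htwo
    obtain ⟨hb'P, hrb'⟩ := mem_below_iff.1 hb'
    have hWb' : a ∪ b' ∈ crossJoins P r := mem_crossJoins_iff.2 ⟨a, haP, b', hb'P, hra, hrb', rfl⟩
    have : 2 ≤ #(crossJoins P r) := by
      have hsub : ({a ∪ b', a ∪ b} : Finset (Finset α)) ⊆ crossJoins P r := by
        intro W hW
        rcases mem_insert.1 hW with rfl | hW
        · exact hWb'
        · rw [mem_singleton.1 hW]; exact hWb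
      have := card_le_card hsub
      rwa [card_pair hne] at this
    omega
  · -- all cross joins equal `a ∪ b`; then the cross meet `a ∩ b` is new
    push Not at htwo
    have hZ : a ∩ b ∈ newMeets P r := by
      unfold newMeets
      refine mem_sdiff.2 ⟨mem_crossMeets_iff.2 ⟨a, haP, b, hbP, hra, hrb, rfl⟩, ?_⟩
      intro hold
      obtain ⟨d, hd, d', hd', hdd', he⟩ := mem_meets_iff.1 hold
      obtain ⟨hdP, hrd⟩ := mem_below_iff.1 hd
      obtain ⟨hd'P, hrd'⟩ := mem_below_iff.1 hd'
      have hud : a ∪ d = a ∪ b := htwo d hd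
      have hud' : a ∪ d' = a ∪ b := htwo d' hd'
      -- b \ a ⊆ d ∩ d' = a ∩ b ⊆ a, hence b ⊆ a
      have hba : b ⊆ a := by
        intro x hxb
        by_contra hxa
        have hxd : x ∈ d := by
          have : x ∈ a ∪ d := by rw [hud]; exact mem_union_right _ hxb
          rcases mem_union.1 this with h | h
          · exact absurd h hxa
          · exact h
        have hxd' : x ∈ d' := by
          have : x ∈ a ∪ d' := by rw [hud']; exact mem_union_right _ hxb
          rcases mem_union.1 this with h | h
          · exact absurd h hxa
          · exact h
        have : x ∈ a ∩ b := by rw [he]; exact mem_inter.2 ⟨hxd, hxd'⟩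
        exact hxa (mem_inter.1 this).1
      have hne : b ≠ a := by rintro rfl; exact hrb hra
      exact hanti (mem_coe.2 hbP) (mem_coe.2 haP) hne hba
    have h1Z : 1 ≤ #(newMeets P r) := card_pos.2 ⟨_, hZ⟩
    have h1W : 1 ≤ #(crossJoins P r) := card_pos.2 ⟨_, hWb⟩
    omega

/-- **One-sided step (a single member avoids `r`)**, the dual statement. [this work] -/
theorem two_le_newLabels_of_card_below_eq_one {P : Finset (Finset α)} {r : α}
    (hanti : IsAntichain (· ⊆ ·) (P : Set (Finset α))) (h2 : 2 ≤ #P) (h1 : #(below P r) = 1) :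
    2 ≤ newLabels P r := by
  obtain ⟨b, hbB⟩ := card_eq_one.1 h1
  have hb : b ∈ below P r := by rw [hbB]; exact mem_singleton_self b
  obtain ⟨hbP, hrb⟩ := mem_below_iff.1 hb
  have hA : (above P r).Nonempty := by
    rw [← card_pos]
    have := card_above_add_card_below P r
    omega
  obtain ⟨a, ha⟩ := hA
  obtain ⟨haP, hra⟩ := mem_above_iff.1 ha
  have hM : meets (below P r) = ∅ := meets_eq_empty_of_card_le_one (by rw [h1])
  have hnewM : newMeets P r = crossMeets P r := by unfold newMeets; rw [hM, sdiff_empty]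
  have hZa : a ∩ b ∈ crossMeets P r := mem_crossMeets_iff.2 ⟨a, haP, b, hbP, hra, hrb, rfl⟩
  unfold newLabels
  rw [hnewM]
  by_cases htwo : ∃ a' ∈ above P r, a' ∩ b ≠ a ∩ b
  · obtain ⟨a', ha', hne⟩ := htwo
    obtain ⟨ha'P, hra'⟩ := mem_above_iff.1 ha'
    have hZa' : a' ∩ b ∈ crossMeets P r := mem_crossMeets_iff.2 ⟨a', ha'P, b, hbP, hra', hrb, rfl⟩
    have : 2 ≤ #(crossMeets P r) := by
      have hsub : ({a' ∩ b, a ∩ b} : Finset (Finset α)) ⊆ crossMeets P r := by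
        intro Z hZ
        rcases mem_insert.1 hZ with rfl | hZ
        · exact hZa'
        · rw [mem_singleton.1 hZ]; exact hZa
      have := card_le_card hsub
      rwa [card_pair hne] at this
    omega
  · -- all cross meets equal `a ∩ b`; then the cross join `a ∪ b` is new
    push Not at htwo
    have hW : a ∪ b ∈ newJoins P r := by
      unfold newJoins
      refine mem_sdiff.2 ⟨mem_crossJoins_iff.2 ⟨a, haP, b, hbP, hra, hrb, rfl⟩, ?_⟩
      intro hold
      obtain ⟨c, hc, c', hc', hcc', he⟩ := mem_joins_iff.1 hold
      obtain ⟨hcP, hrc⟩ := mem_above_iff.1 hc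
      obtain ⟨hc'P, hrc'⟩ := mem_above_iff.1 hc'
      have hic : c ∩ b = a ∩ b := htwo c hc
      have hic' : c' ∩ b = a ∩ b := htwo c' hc'
      -- c ⊆ a: a point of c is in b (then in c ∩ b = a ∩ b ⊆ a) or not (then in (a ∪ b) \ b ⊆ a)
      have hsub : ∀ {e : Finset α}, e ∈ P → e ∩ b = a ∩ b → e ⊆ a ∪ b → e = a := by
        intro e heP hie heu
        have hea : e ⊆ a := by
          intro x hxe
          by_cases hxb : x ∈ b
          · have : x ∈ a ∩ b := by rw [← hie]; exact mem_inter.2 ⟨hxe, hxb⟩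
            exact (mem_inter.1 this).1
          · rcases mem_union.1 (heu hxe) with h | h
            · exact h
            · exact absurd h hxb
        by_contra hne
        exact hanti (mem_coe.2 heP) (mem_coe.2 haP) hne hea
      have hcu : c ⊆ a ∪ b := by rw [he]; exact subset_union_left
      have hc'u : c' ⊆ a ∪ b := by rw [he]; exact subset_union_right
      have h1 := hsub hcP hic hcu
      have h2 := hsub hc'P hic' hc'u
      exact hcc' (h1.trans h2.symm)
    have h1W : 1 ≤ #(newJoins P r) := card_pos.2 ⟨_, hW⟩
    have h1Z : 1 ≤ #(crossMeets P r) := card_pos.2 ⟨_, hZa⟩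
    omega

end Summit.CriticalPhenomena.PercolationContinuityZ3.Theorems.SahiColouredDaykin
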